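import Mathlib.MeasureTheory.Function.LpSpace.Complete
import Literature.Analysis.FunctionSpaces.TorusSpaceTimeL3Cauchy
import HarnessLib

/-!
# Stub `stub_krLimitOfCauchy` (H6) of the plan for `stub_kolmogorovRieszPeriodicSlab`
(line `tight`, crux `EulerLimit.EulerlimitThesisV2`, stmt-AnomalousDissipation-0511)

The strong `L³((0,T) × T^d)` limit of a family of jointly measurable fields that is Cauchy in the
junk-free nested-`lintegral` sense: along a fast further subsequence (`n`-th error `≤ 2^{-3(n+1)}`)
Mathlib's `MeasureTheory.Lp.cauchy_complete_eLpNorm` (completeness of `L³`) produces a limit in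
`L³((vol|(0,T)) ⊗ vol)`, which is curried back to a field `V : ℝ → T^d → ℝ^d`.  This is verbatim
Steps 3–5 of the tree's discharge `Literature.Barriers.AnomalousDissipation.DeRosaIsett2024_s61_compactness_holds`
(`IntermittentDissipationCompactness`), isolated as a lemma (that file is a `Barriers` module and is
not imported here; its 12-line `exists_fast_subseq` is re-proved privately).  Generic in `d`; the file
ends with the REGISTERED sub-stub `stub_krLimitOfCauchy` (`d = Fin 3`), signature verbatim.
-/

noncomputable section

-- D-0017: single-problem summit ⇒ the duplicated namespace segment is by design.
set_option linter.dupNamespace false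

open MeasureTheory Set Function Filter
open scoped ENNReal Topology

namespace Summit.AnomalousDissipation.AnomalousDissipation.Theorems.EulerLimitKR

open Literature.Analysis.FunctionSpaces Literature.Analysis.FunctionSpaces.Torus

/-- **Fast subsequences.** If for every `j` the pairs beyond `N j` are `e j`-close
(`a n m ≤ e j` for `n, m ≥ N j`), then along `ψ n = max_{i ≤ n} N i + n` (strictly increasing) one
has `a (ψ n) (ψ m) ≤ e j` whenever `j ≤ n` and `j ≤ m` (private copy of the `Barriers`-side
`Literature.Barriers.AnomalousDissipation.exists_fast_subseq`, not importable into a Theorems file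
by layering). [folklore] -/
private theorem exists_fast_subseq {a : ℕ → ℕ → ℝ≥0∞} {e : ℕ → ℝ≥0∞} {N : ℕ → ℕ}
    (h : ∀ j n m, N j ≤ n → N j ≤ m → a n m ≤ e j) :
    ∃ ψ : ℕ → ℕ, StrictMono ψ ∧ ∀ j n m, j ≤ n → j ≤ m → a (ψ n) (ψ m) ≤ e j := by
  set ψ : ℕ → ℕ := fun n => (Finset.range (n + 1)).sup N + n with hψ
  have hψN : ∀ j n, j ≤ n → N j ≤ ψ n := fun j n hjn =>
    (Finset.le_sup (f := N) (Finset.mem_range.2 (Nat.lt_succ_of_le hjn))).trans (Nat.le_add_right _ _)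
  refine ⟨ψ, strictMono_nat_of_lt_succ fun n => ?_, fun j n m hjn hjm =>
    h j (ψ n) (ψ m) (hψN j n hjn) (hψN j m hjm)⟩
  have hmono : (Finset.range (n + 1)).sup N ≤ (Finset.range (n + 1 + 1)).sup N :=
    Finset.sup_mono (Finset.range_mono (Nat.le_succ _))
  simp only [hψ]
  omega

/-- **Strong `L³((0,T) × T^d)` limit of a nested-`L³` Cauchy family (H6).** Let
`W n : ℝ → T^d → ℝ^d` be jointly a.e.-strongly measurable for `(vol|(0,T)) ⊗ vol` with
`∫₀ᵀ∫ ‖W n‖³ ≤ B < ∞`, and Cauchy: for every `η > 0` there is `N` with `∫₀ᵀ∫ ‖W n - W m‖³ ≤ η`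
for `n, m ≥ N`.  Then along a strictly increasing `ψ` the fields converge in `L³((0,T) × T^d)`
(nested lower integrals) to a jointly a.e.-strongly measurable `V` (fast subsequence with errors
`≤ 2^{-3(j+1)}`, then `Lp.cauchy_complete_eLpNorm`; Steps 3–5 of the tree's
`DeRosaIsett2024_s61_compactness_holds`). [folklore] -/
theorem exists_subseq_tendsto_of_cauchy_L3
    {d : Type*} [Fintype d] {T : ℝ}
    {W : ℕ → ℝ → UnitAddTorus d → EuclideanSpace ℝ d}
    (hWm : ∀ n, AEStronglyMeasurable (uncurry (W n)) ((volume.restrict (Ioo 0 T)).prod volume))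
    {B : ℝ≥0∞} (hB : B ≠ ⊤) (hWB : ∀ n, ∫⁻ t in Ioo 0 T, ∫⁻ x, ‖W n t x‖ₑ ^ 3 ≤ B)
    (hcau : ∀ η : ℝ≥0∞, 0 < η → ∃ N : ℕ, ∀ n m : ℕ, N ≤ n → N ≤ m →
      ∫⁻ t in Ioo 0 T, ∫⁻ x, ‖W n t x - W m t x‖ₑ ^ 3 ≤ η) :
    ∃ (ψ : ℕ → ℕ) (V : ℝ → UnitAddTorus d → EuclideanSpace ℝ d), StrictMono ψ ∧
      AEStronglyMeasurable (uncurry V) ((volume.restrict (Ioo 0 T)).prod volume) ∧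
      Tendsto (fun n => ∫⁻ t in Ioo 0 T, ∫⁻ x, ‖W (ψ n) t x - V t x‖ₑ ^ 3) atTop (𝓝 0) := by
  -- Step 1: a fast subsequence
  set r : ℝ≥0∞ := 2⁻¹ with hr
  have hr1 : r ≤ 1 := by rw [hr]; exact ENNReal.inv_le_one.2 one_le_two
  have hr0 : 0 < r := by rw [hr]; exact ENNReal.inv_pos.2 ENNReal.ofNat_ne_top
  set e : ℕ → ℝ≥0∞ := fun j => (r ^ (j + 1)) ^ 3 with he
  have he0 : ∀ j, 0 < e j := fun j => ENNReal.pow_pos (ENNReal.pow_pos hr0 _) 3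
  choose Nc hNc using fun j => hcau (e j) (he0 j)
  obtain ⟨ψ, hψ, hfast⟩ := exists_fast_subseq
    (a := fun n m => ∫⁻ t in Ioo 0 T, ∫⁻ x, ‖W n t x - W m t x‖ₑ ^ 3) hNc
  -- Step 2: completeness of `L³((0,T) × T^d)`
  set μT : Measure (ℝ × UnitAddTorus d) := (volume.restrict (Ioo 0 T)).prod volume with hμT
  set U : ℕ → ℝ × UnitAddTorus d → EuclideanSpace ℝ d := fun n => uncurry (W (ψ n)) with hU
  have hUm : ∀ n, AEStronglyMeasurable (U n) μT := fun n => hWm (ψ n)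
  have hcube : ∀ a : ℝ≥0∞, (a ^ (1 / 3 : ℝ)) ^ 3 = a := fun a => by
    rw [show (1 / 3 : ℝ) = ((3 : ℕ) : ℝ)⁻¹ by norm_num, ENNReal.rpow_inv_natCast_pow (by norm_num)]
  have hUmem : ∀ n, MemLp (U n) 3 μT := fun n => by
    refine ⟨hUm n, ?_⟩
    rw [hU, eLpNorm_uncurry_three_eq (hUm n)]
    exact ENNReal.rpow_lt_top_of_nonneg (by norm_num) (ne_top_of_le_ne_top hB (hWB _))
  have hdiff : ∀ n m, eLpNorm (U n - U m) 3 μT =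
      (∫⁻ t in Ioo 0 T, ∫⁻ x, ‖W (ψ n) t x - W (ψ m) t x‖ₑ ^ 3) ^ (1 / 3 : ℝ) := by
    intro n m
    have h1 : U n - U m = uncurry (fun t x => W (ψ n) t x - W (ψ m) t x) := rfl
    rw [h1, eLpNorm_uncurry_three_eq ((hUm n).sub (hUm m))]
  have hsum : ∑' i, r ^ i ≠ ∞ := by
    rw [hr, ENNReal.tsum_geometric_two]
    exact ENNReal.ofNat_ne_top
  have h_cau : ∀ N n m : ℕ, N ≤ n → N ≤ m → eLpNorm (U n - U m) 3 μT < r ^ N := by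
    intro N n m hn hm
    set j : ℕ := min n m with hj
    have hjN : N ≤ j := le_min hn hm
    have h1 : ∫⁻ t in Ioo 0 T, ∫⁻ x, ‖W (ψ n) t x - W (ψ m) t x‖ₑ ^ 3 ≤ e j :=
      hfast j n m (min_le_left _ _) (min_le_right _ _)
    have h2 : eLpNorm (U n - U m) 3 μT ≤ r ^ (j + 1) := by
      rw [hdiff]
      calc (∫⁻ t in Ioo 0 T, ∫⁻ x, ‖W (ψ n) t x - W (ψ m) t x‖ₑ ^ 3) ^ (1 / 3 : ℝ)
          ≤ (e j) ^ (1 / 3 : ℝ) := rpow_third_le_rpow_third h1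
        _ = r ^ (j + 1) := pow_three_rpow_third _
    have h3 : r ^ (j + 1) ≤ r ^ (N + 1) := pow_le_pow_right_of_le_one' hr1 (Nat.succ_le_succ hjN)
    have h4 : r ^ (N + 1) < r ^ N := by
      rw [pow_succ, hr]
      exact ENNReal.half_lt_self (pow_ne_zero _ (ENNReal.inv_ne_zero.2 ENNReal.ofNat_ne_top))
        (ENNReal.pow_ne_top (ENNReal.inv_ne_top.2 two_ne_zero))
    exact h2.trans_lt (h3.trans_lt h4)
  obtain ⟨Vl, hVmem, hVlim⟩ :=
    Lp.cauchy_complete_eLpNorm (by norm_num : (1 : ℝ≥0∞) ≤ 3) hUmem hsum h_cau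
  -- Step 3: unpack
  set V : ℝ → UnitAddTorus d → EuclideanSpace ℝ d := curry Vl with hV
  have hvV : uncurry V = Vl := uncurry_curry Vl
  have hVm : AEStronglyMeasurable (uncurry V) μT := by rw [hvV]; exact hVmem.1
  refine ⟨ψ, V, hψ, hVm, ?_⟩
  have h1 : ∀ k, ∫⁻ t in Ioo 0 T, ∫⁻ x, ‖W (ψ k) t x - V t x‖ₑ ^ (3 : ℕ) =
      eLpNorm (U k - Vl) 3 μT ^ 3 := by
    intro k
    have h2 : U k - Vl = uncurry (fun t x => W (ψ k) t x - V t x) := by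
      rw [← hvV]
      rfl
    rw [h2, eLpNorm_uncurry_three_eq ((hUm k).sub hVm), hcube]
  simp_rw [h1]
  have h3 := ((ENNReal.continuous_pow 3).tendsto 0).comp hVlim
  simpa [Function.comp_def] using h3

/-- **Registered sub-stub `stub_krLimitOfCauchy`** (H6 of the STUB-PLAN for
`stub_kolmogorovRieszPeriodicSlab`, `d = Fin 3`): the strong `L³((0,T) × 𝕋³)` limit of a
nested-`lintegral` Cauchy family along a subsequence (`exists_subseq_tendsto_of_cauchy_L3`). [folklore] -/
theorem stub_krLimitOfCauchy :
    ∀ (T : ℝ) (B : ENNReal) (W : ℕ → ℝ → UnitAddTorus (Fin 3) → EuclideanSpace ℝ (Fin 3)), (∀ n, MeasureTheory.AEStronglyMeasurable (Function.uncurry (W n)) ((MeasureTheory.volume.restrict (Set.Ioo 0 T)).prod MeasureTheory.volume)) → B ≠ ⊤ → (∀ n, ∫⁻ t in Set.Ioo 0 T, ∫⁻ x, ‖W n t x‖ₑ ^ 3 ≤ B) → (∀ η : ENNReal, 0 < η → ∃ N : ℕ, ∀ n m : ℕ, N ≤ n → N ≤ m → ∫⁻ t in Set.Ioo 0 T, ∫⁻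 x, ‖W n t x - W m t x‖ₑ ^ 3 ≤ η) → ∃ (ψ : ℕ → ℕ) (V : ℝ → UnitAddTorus (Fin 3) → EuclideanSpace ℝ (Fin 3)), StrictMono ψ ∧ MeasureTheory.AEStronglyMeasurable (Function.uncurry V) ((MeasureTheory.volume.restrict (Set.Ioo 0 T)).prod MeasureTheory.volume) ∧ Filter.Tendsto (fun n => ∫⁻ t in Set.Ioo 0 T, ∫⁻ x, ‖W (ψ n) t x - V t x‖ₑ ^ 3) Filter.atTop (nhds 0) :=
  fun _T _B _W hWm hB hWB hcau => exists_subseq_tendsto_of_cauchy_L3 hWm hB hWB hcau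

end Summit.AnomalousDissipation.AnomalousDissipation.Theorems.EulerLimitKR

end
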